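import Summits.Ventures.PercRepro.ThetaOmegaCoreMech

/-!
# Pairs of bad edges: chained or in general position, and the mono colours

Dossier proofs/MINE1-theoremS.md, Addendum 81 (mine-1, gen 42). A **bad edge** `(s, s + q)`
(`BadEdge`) is an exceptional edge (`c0 (s + q) ≠ c1 s`) at a point of credit `0`. Two bad
edges in directions `q ≠ r` are **chained** (`Chained`: one starts at the upper end of the other)
or in **general position** (`NonDeg`: no common endpoint); the V and Λ shapes are excluded in
`ThetaOmegaCoreThree.lean`.

In general position the pair mechanisms of `ThetaOmegaCoreMech.lean` force the **type** of each
edge from the position of the other point: `nondeg_c0_eq_of_mem` (`q ∈ t ⟹ c0 t = c0 (t + r)`,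
by the meet–meet or the cross-difference mechanism) and `nondeg_c1_eq_of_notMem`
(`q ∉ t ⟹ c1 t = c1 (t + r)`, by the difference–difference or the co-join mechanism); with the
near-constant colourings of `colours_of_credit_eq_zero` (`badEdge_c0_ne_monoColour`,
`badEdge_c1_ne_monoColour`) the two **mono colours** (`monoColour`: the colour of the mono endpoint
of a typed edge) are complementary (`nonDeg_monoColour_ne`). The Boolean cores `bool_chain3` and
`bool_cfg3` of the three-edge configurations are decided here.
-/

namespace PercRepro.MSTight

open Finset

variable {α : Type*} [DecidableEq α]

section Defs

variable {q r : α} {U : Finset α} {F : Finset (Finset α)} {c0 c1 : Finset α → Bool}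
  {s t w : Finset α}

/-- **A bad edge** `(s, s + q)`: an exceptional edge at a point of credit `0`. -/
def BadEdge (U : Finset α) (F : Finset (Finset α)) (c0 c1 : Finset α → Bool) (q : α)
    (s : Finset α) : Prop :=
  q ∈ U ∧ s ∈ F ∧ q ∉ s ∧ insert q s ∈ F ∧ c0 (insert q s) ≠ c1 s ∧ omegaCredit U F c0 c1 q = 0

/-- The type disjunction of `one_edge_type` for an edge with lower colours `(a, b)` and upper
colours `(c, d)`: T10, T01 or T00. -/
def EdgeTyped (a b c d : Bool) : Prop :=
  (a = c ∧ d = c ∧ b ≠ c) ∨ (b = d ∧ a = b ∧ c ≠ b) ∨ (a = b ∧ c = d ∧ a ≠ c)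

/-- **The mono colour** of an edge: the colour of its mono endpoint for a typed edge (`c0 s` for
T10, `c1 s` for T01 and T00). -/
def monoColour (c0 c1 : Finset α → Bool) (q : α) (s : Finset α) : Bool :=
  if c0 s = c0 (insert q s) then c0 s else c1 s

/-- **Two bad edges are chained**: one starts at the upper end of the other. -/
def Chained (q : α) (s : Finset α) (r : α) (t : Finset α) : Prop :=
  t = insert q s ∨ insert r t = s

/-- **Two bad edges in general position**: no common endpoint. -/
def NonDeg (q : α) (s : Finset α) (r : α) (t : Finset α) : Prop :=
  t ≠ s ∧ t ≠ insert q s ∧ insert r t ≠ s ∧ insert r t ≠ insert q s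

/-- Chaining is symmetric. -/
theorem chained_symm (h : Chained q s r t) : Chained r t q s := by
  rcases h with h | h
  · exact Or.inr h.symm
  · exact Or.inl h.symm

/-- General position is symmetric. -/
theorem nonDeg_symm (h : NonDeg q s r t) : NonDeg r t q s :=
  ⟨Ne.symm h.1, Ne.symm h.2.2.1, Ne.symm h.2.1, Ne.symm h.2.2.2⟩

/-- A bad edge with a third member is typed. -/
theorem badEdge_typed (h : BadEdge U F c0 c1 q s) (hw : w ∈ F) (hws : w ≠ s)
    (hwu : w ≠ insert q s) :
    EdgeTyped (c0 s) (c1 s) (c0 (insert q s)) (c1 (insert q s)) :=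
  one_edge_type h.1 h.2.1 h.2.2.1 h.2.2.2.1 h.2.2.2.2.1 h.2.2.2.2.2 hw hws hwu

/-- The constraint of `colours_of_credit_eq_zero` at a bad edge. -/
theorem badEdge_colours (h : BadEdge U F c0 c1 q s) (hw : w ∈ F) (hws : w ≠ s)
    (hwu : w ≠ insert q s) :
    (q ∈ w → (c0 s = c0 (insert q s) → c0 w ≠ c0 s) ∧ (c1 s = c1 (insert q s) → c0 w ≠ c1 s)) ∧
      (q ∉ w → (c1 s = c1 (insert q s) → c1 w ≠ c1 s) ∧
        (c0 s = c0 (insert q s) → c1 w ≠ c0 s)) :=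
  colours_of_credit_eq_zero h.1 h.2.1 h.2.2.1 h.2.2.2.1 h.2.2.2.2.2 hw hws hwu

/-- **The colour rule, `q ∈ w`**: at a typed bad edge every other member containing `q` has
`c0` different from the mono colour. -/
theorem badEdge_c0_ne_monoColour (h : BadEdge U F c0 c1 q s)
    (ht : c0 s = c0 (insert q s) ∨ c1 s = c1 (insert q s)) (hw : w ∈ F) (hws : w ≠ s)
    (hwu : w ≠ insert q s) (hqw : q ∈ w) : c0 w ≠ monoColour c0 c1 q s := by
  have hc := (badEdge_colours h hw hws hwu).1 hqw
  unfold monoColour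
  by_cases h10 : c0 s = c0 (insert q s)
  · rw [if_pos h10]; exact hc.1 h10
  · rw [if_neg h10]
    exact hc.2 (ht.resolve_left h10)

/-- **The colour rule, `q ∉ w`**: at a typed bad edge every other member avoiding `q` has `c1`
different from the mono colour. -/
theorem badEdge_c1_ne_monoColour (h : BadEdge U F c0 c1 q s)
    (ht : c0 s = c0 (insert q s) ∨ c1 s = c1 (insert q s)) (hw : w ∈ F) (hws : w ≠ s)
    (hwu : w ≠ insert q s) (hqw : q ∉ w) : c1 w ≠ monoColour c0 c1 q s := by
  have hc := (badEdge_colours h hw hws hwu).2 hqw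
  unfold monoColour
  by_cases h10 : c0 s = c0 (insert q s)
  · rw [if_pos h10]; exact hc.2 h10
  · rw [if_neg h10]
    exact hc.1 (ht.resolve_left h10)

/-- Credit from a `q`-edge of `A` contradicts a bad edge. -/
theorem badEdge_not_mem_qEdges (h : BadEdge U F c0 c1 q s) {d : Finset α}
    (hd : d ∈ qEdges q (omegaA F c0 c1)) : False := by
  have := one_le_omegaCredit_of_mem_qEdges_omegaA (U := U) hd
  have h0 := h.2.2.2.2.2
  omega

/-- Credit from a `q`-edge of `C` contradicts a bad edge. -/
theorem badEdge_not_mem_qEdges_omegaC (h : BadEdge U F c0 c1 q s) {d : Finset α}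
    (hd : d ∈ qEdges q (omegaC U F c1)) : False := by
  have := one_le_omegaCredit_of_mem_qEdges_omegaC (c0 := c0) hd
  have h0 := h.2.2.2.2.2
  omega

/-- Picking, among two members of different colours, the one of a prescribed colour. -/
theorem exists_of_ne {β : Type*} (f : β → Bool) {x y : β} (h : f x ≠ f y) (b : Bool) :
    ∃ z, (z = x ∨ z = y) ∧ f z = b := by
  by_cases hx : f x = b
  · exact ⟨x, Or.inl rfl, hx⟩
  · exact ⟨y, Or.inr rfl, bool_eq_of_ne_of_ne (Ne.symm h) (Ne.symm hx)⟩

omit [DecidableEq α] in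
/-- Two sets are different when an element lies in exactly one of them. -/
theorem ne_of_mem_notMem {x y : Finset α} {a : α} (hx : a ∈ x) (hy : a ∉ y) : x ≠ y :=
  fun h => hy (h ▸ hx)

end Defs

section L1

variable {q r : α} {U : Finset α} {F : Finset (Finset α)} {c0 c1 : Finset α → Bool}
  {s t : Finset α}

/-- **General position, `q ∈ t`**: the edge at `r` is `c0`-consistent (else the meet–meet or the
cross-difference mechanism pays `q`). -/
theorem nondeg_c0_eq_of_mem (hq : BadEdge U F c0 c1 q s) (hr : BadEdge U F c0 c1 r t)
    (hnd : NonDeg q s r t) (hqt : q ∈ t) : c0 t = c0 (insert r t) := by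
  by_contra hne
  have hsF := hq.2.1
  have hqs := hq.2.2.1
  have huF := hq.2.2.2.1
  have htF := hr.2.1
  have hvF := hr.2.2.2.1
  obtain ⟨hts, htu, hvs, hvu⟩ := hnd
  have hqv : q ∈ insert r t := mem_insert_of_mem hqt
  have hmemF : ∀ z, (z = t ∨ z = insert r t) → z ∈ F := by
    rintro z (rfl | rfl)
    · exact htF
    · exact hvF
  have hmemq : ∀ z, (z = t ∨ z = insert r t) → q ∈ z := by
    rintro z (rfl | rfl)
    · exact hqt
    · exact hqv
  have hne_s : ∀ z, (z = t ∨ z = insert r t) → z ≠ s := by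
    rintro z (rfl | rfl)
    · exact hts
    · exact hvs
  have hne_u : ∀ z, (z = t ∨ z = insert r t) → z ≠ insert q s := by
    rintro z (rfl | rfl)
    · exact htu
    · exact hvu
  by_cases hrs : r ∈ s
  · -- the cross-difference mechanism: `z \ (s + q)` is the same for `z = t, t + r`
    have heq : ∀ z, (z = t ∨ z = insert r t) → z \ insert q s = t \ insert q s := by
      rintro z (rfl | rfl)
      · rfl
      · exact insert_sdiff_of_mem t (mem_insert_of_mem hrs)
    obtain ⟨x, hx, hxc⟩ := exists_of_ne c0 hne (c1 s)
    obtain ⟨y, hy, hyc⟩ := exists_of_ne c0 hne (c1 (insert q s))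
    exact badEdge_not_mem_qEdges hq (qEdge_of_cross hsF hqs huF (hmemF x hx) (hmemq x hx) hxc
      (hmemF y hy) hyc ((heq x hx).trans (heq y hy).symm))
  · -- the meet–meet mechanism: `s ⊓ z` is the same for `z = t, t + r`
    have heq : ∀ z, (z = t ∨ z = insert r t) → s ⊓ z = s ⊓ t := by
      rintro z (rfl | rfl)
      · rfl
      · exact inf_insert_of_notMem hrs t
    obtain ⟨y, hy, hyc⟩ := exists_of_ne c0 hne (c0 s)
    obtain ⟨x, hx, hxc⟩ := exists_of_ne c0 hne (c0 (insert q s))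
    exact badEdge_not_mem_qEdges hq (qEdge_of_inf_inf hsF hqs huF (hmemF y hy) (hne_s y hy) hyc
      (hmemF x hx) (hne_u x hx) hxc (hmemq x hx) ((heq y hy).trans (heq x hx).symm))

/-- **General position, `q ∉ t`**: the edge at `r` is `c1`-consistent (else the
difference–difference or the co-join mechanism pays `q`). -/
theorem nondeg_c1_eq_of_notMem (hq : BadEdge U F c0 c1 q s) (hr : BadEdge U F c0 c1 r t)
    (hqr : q ≠ r) (hnd : NonDeg q s r t) (hqt : q ∉ t) : c1 t = c1 (insert r t) := by
  by_contra hne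
  have hqU := hq.1
  have hsF := hq.2.1
  have hqs := hq.2.2.1
  have huF := hq.2.2.2.1
  have htF := hr.2.1
  have hvF := hr.2.2.2.1
  obtain ⟨hts, htu, hvs, hvu⟩ := hnd
  have hqv : q ∉ insert r t := by
    simp only [mem_insert, not_or]; exact ⟨hqr, hqt⟩
  have hmemF : ∀ z, (z = t ∨ z = insert r t) → z ∈ F := by
    rintro z (rfl | rfl)
    · exact htF
    · exact hvF
  have hmemq : ∀ z, (z = t ∨ z = insert r t) → q ∉ z := by
    rintro z (rfl | rfl)
    · exact hqt
    · exact hqv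
  have hne_s : ∀ z, (z = t ∨ z = insert r t) → z ≠ s := by
    rintro z (rfl | rfl)
    · exact hts
    · exact hvs
  have hne_u : ∀ z, (z = t ∨ z = insert r t) → z ≠ insert q s := by
    rintro z (rfl | rfl)
    · exact htu
    · exact hvu
  by_cases hrs : r ∈ s
  · -- the co-join mechanism: `s ⊔ z` is the same for `z = t, t + r`
    have heq : ∀ z, (z = t ∨ z = insert r t) → s ⊔ z = s ⊔ t := by
      rintro z (rfl | rfl)
      · rfl
      · rw [sup_eq_union, union_insert, insert_eq_of_mem (mem_union_left t hrs), sup_eq_union]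
    obtain ⟨y, hy, hyc⟩ := exists_of_ne c1 hne (c1 s)
    obtain ⟨x, hx, hxc⟩ := exists_of_ne c1 hne (c1 (insert q s))
    exact badEdge_not_mem_qEdges_omegaC hq (qEdge_of_cojoin hqU hsF hqs huF (hmemF y hy)
      (hne_s y hy) hyc (hmemF x hx) (hne_u x hx) hxc (hmemq x hx)
      ((heq y hy).trans (heq x hx).symm))
  · -- the difference–difference mechanism: `s \ z` is the same for `z = t, t + r`
    have heq : ∀ z, (z = t ∨ z = insert r t) → s \ z = s \ t := by
      rintro z (rfl | rfl)
      · rfl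
      · exact sdiff_insert_of_notMem hrs t
    obtain ⟨y, hy, hyc⟩ := exists_of_ne c1 hne (c0 s)
    obtain ⟨x, hx, hxc⟩ := exists_of_ne c1 hne (c0 (insert q s))
    exact badEdge_not_mem_qEdges hq (qEdge_of_sdiff_sdiff hsF hqs huF (hmemF y hy) hyc.symm
      (hmemF x hx) hxc.symm (hmemq x hx) ((heq y hy).trans (heq x hx).symm))

/-- In general position the edge at `r` is typed in the direction of `q`'s position. -/
theorem nonDeg_typed (hq : BadEdge U F c0 c1 q s) (hr : BadEdge U F c0 c1 r t) (hqr : q ≠ r)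
    (hnd : NonDeg q s r t) : c0 t = c0 (insert r t) ∨ c1 t = c1 (insert r t) := by
  by_cases hqt : q ∈ t
  · exact Or.inl (nondeg_c0_eq_of_mem hq hr hnd hqt)
  · exact Or.inr (nondeg_c1_eq_of_notMem hq hr hqr hnd hqt)

/-- **In general position the two mono colours are complementary.** -/
theorem nonDeg_monoColour_ne (hq : BadEdge U F c0 c1 q s) (hr : BadEdge U F c0 c1 r t)
    (hqr : q ≠ r) (hnd : NonDeg q s r t) : monoColour c0 c1 r t ≠ monoColour c0 c1 q s := by
  have htyq := nonDeg_typed hr hq (Ne.symm hqr) (nonDeg_symm hnd)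
  have htF := hr.2.1
  by_cases hqt : q ∈ t
  · have h10 := nondeg_c0_eq_of_mem hq hr hnd hqt
    unfold monoColour
    rw [if_pos h10]
    have := badEdge_c0_ne_monoColour hq htyq htF hnd.1 hnd.2.1 hqt
    unfold monoColour at this
    exact this
  · have h01 := nondeg_c1_eq_of_notMem hq hr hqr hnd hqt
    have h10 : c0 t ≠ c0 (insert r t) := by
      intro h10
      -- both ends anti with the same colours: the third member `s` pays `r`
      have hanti : c0 t ≠ c1 t := fun h => hr.2.2.2.2.1 (h10.symm.trans h)
      have := one_le_credit_of_anti_same (c0 := c0) (c1 := c1) hr.1 hr.2.1 hr.2.2.1 hr.2.2.2.1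
        h10.symm h01.symm hanti hq.2.1 (Ne.symm hnd.1) (Ne.symm hnd.2.2.1)
      have h0 := hr.2.2.2.2.2
      unfold omegaCredit at h0
      omega
    unfold monoColour
    rw [if_neg h10]
    have := badEdge_c1_ne_monoColour hq htyq htF hnd.1 hnd.2.1 hqt
    unfold monoColour at this
    exact this

end L1

section Bool

set_option synthInstance.maxSize 65536 in
/-- The Boolean core of the three-edge path: colours `(a, b), (c, d), (e, f), (g, h)` along a
path of three exceptional typed edges whose outer edges are consistent across the path. -/
theorem bool_chain3 (a b c d e f g h : Bool) (h1 : c ≠ b) (h2 : e ≠ d) (h3 : g ≠ f)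
    (t1 : EdgeTyped a b c d) (t2 : EdgeTyped c d e f) (t3 : EdgeTyped e f g h)
    (hL1 : b = d) (hL2 : e = g) : False := by
  unfold EdgeTyped at t1 t2 t3
  revert a b c d e f g h
  decide

set_option synthInstance.maxSize 65536 in
/-- The Boolean core of a chained pair with equal mono colours whose third point is in general
position with both. -/
theorem bool_cfg3 (a b c d e f : Bool) (h1 : c ≠ b) (h2 : e ≠ d)
    (t1 : EdgeTyped a b c d) (t2 : EdgeTyped c d e f)
    (hmc : (if a = c then a else b) = (if c = e then c else d))
    (hL : (a = c ∧ c = e) ∨ (b = d ∧ (c = e ∨ d = f))) : False := by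
  unfold EdgeTyped at t1 t2
  revert a b c d e f
  decide

/-- Three Booleans cannot be pairwise different. -/
theorem bool_three_ne (x y z : Bool) (hxy : x ≠ y) (hxz : x ≠ z) (hyz : y ≠ z) : False := by
  revert x y z; decide

/-- Two Booleans different from a third are equal. -/
theorem bool_eq_of_ne_of_ne' (x y z : Bool) (hxy : x ≠ y) (hxz : x ≠ z) : y = z := by
  revert x y z; decide

end Bool

end PercRepro.MSTight
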